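import Summits.CriticalPhenomena.Ising3D.Control2DTaylorCertificate
import Summits.CriticalPhenomena.Ising3D.Control2DGammaL7CellsA
import Summits.CriticalPhenomena.Ising3D.Control2DGammaL7CellsB
import Summits.CriticalPhenomena.Ising3D.Control2DGammaL7CellsC
import Summits.CriticalPhenomena.Ising3D.Control2DGammaL7CellsD
import Summits.CriticalPhenomena.Ising3D.Control2DGammaL7CellsE
import Summits.CriticalPhenomena.Ising3D.Control2DGammaL7CellsF
import Mathlib.Tactic.IntervalCases
import Mathlib.Tactic.Linarith
import Mathlib.Tactic.NormNum
import HarnessLib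

/-!
# The first 2D γ-certificate replayed in the kernel: `Δ_ε < 1.05` at `Δ_σ = 1/8` by a DERIVATIVE functional
(cell `pub-ising3x`, seat controls-1 gen 15; KERNEL PATH for the 2D γ (derivative-functional)
certificates, step 4 = the assembly — CONTROL-ONLY)

HONEST FRAMING: lottery ticket; floor = tightest certified 3D Ising CFT bounds; no exact-solution
claim without a proof. CONTROL-ONLY: `d = 2`, global conformal blocks, `Δ_σ = 1/8` exact, unitarity
only (the typed `GapExcluded` of `Control2DBootstrap`); this validates the certificate PIPELINE on the
exactly solved 2D Ising model (`Δ_ε = 1`) and says nothing about `d = 3`.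

**`gapExcluded_2d_gamma_L7 : GapExcluded (1/8) (21/20)`** — no unitary crossing solution of the 2D
`⟨σσσσ⟩` sum rule at `Δ_σ = 1/8` has all its non-identity scalars at `Δ ≥ 1.05` — proved ENTIRELY IN
THE LEAN KERNEL from the RB-1 derivative functional of record (controls-1 gen 7, kit j105929: Λ = 7,
ten components `α_{mn} ∂_z^m ∂_z̄^n|_{z=z̄=1/2}`, `m+n` odd, region threshold `E₀ = 24`; certified before
only by the Python readers A ∧ B). The chain: g14's `gapExcluded_half_of_explicit` (termwise action of
Taylor functionals on the sum rule with OPE convergence on the diagonal DERIVED from crossing + the gap,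
truncation `N = 24`) instantiated with
* (I) `ident_L7e105` and (R) `region_L7e105` (`Control2DGammaL7Table`: explicit polynomial identities
  checked by `ring`, signs by `positivity` — for ALL real `b ≥ 0`, `J ∈ ℕ`, `2b + J ≥ 24`);
* (C) the cells `cellL7e105_sℓ`, `ℓ = 0, 2, …, 22` (`Control2DGammaL7CellsA–F`): per spin ONE integer
  polynomial of degree 97 (`Control2DKernelCell.cellPolyZ`) whose Bernstein certificate is decided in the
  kernel (`Control2DPolyCert.bernCheck`, `decide +kernel`, ≈ 30–60 s per spin); spins `ℓ ≥ 24` and all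
  `Δ ≥ 24` are covered by (R).
Weaker than the kernel-complete POINT-functional statement `gapExcluded_2d_sixtySevenSixtyFourths`
(`Δ_ε < 67/64`, controls-1 gen 5) as a bound; new as a METHOD: the derivative-functional (γ) architecture
— the one every certificate of record since RB-1 and the 3D chain use — now has an end-to-end kernel
instance. Total kernel cost ≈ 12 × 30–60 s; zero grant compute. No facts, standard axioms only.
-/

namespace Summit.CriticalPhenomena.Ising3D.Control2D

open Literature.MathematicalPhysics.QuantumFieldTheory.ConformalBootstrap3D

/-- **2D control, γ-architecture, kernel-complete: `Δ_ε < 21/20` at `Δ_σ = 1/8`.** No `CrossingData`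
with `Δσ = 1/8` that `IsUnitary`, `SatisfiesCrossing` and `HasScalarGap (21/20)` exists — from the RB-1
derivative functional j105929 (Λ = 7, E₀ = 24) with every obligation ((I), (R), twelve spin cells)
checked in the Lean kernel. CONTROL-ONLY (d = 2). [cite: RattazziEtAl2008, §5.5] -/
theorem gapExcluded_2d_gamma_L7 : GapExcluded (1 / 8 : ℝ) (21 / 20) := by
  refine gapExcluded_half_of_explicit slL7.toFinset (fun p => (wtL7e105 p : ℝ)) (s := 1 / 8)
    (U := 21 / 20) (E₀ := 24) 24 (by norm_num) (by norm_num) (by norm_num) (by norm_num)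
    ident_L7e105 (fun b J hb hE => region_L7e105 b J hb hE) (fun Δ h1 h2 => cellL7e105_s0 Δ h1 h2.le) ?_
  intro ℓ hℓ hℓ0 Δ hℓΔ hΔ
  have hℓ24R : (ℓ : ℝ) < 24 := lt_of_le_of_lt hℓΔ hΔ
  have hℓ24 : ℓ < 24 := by exact_mod_cast hℓ24R
  interval_cases ℓ
  · exact absurd rfl hℓ0
  · exact absurd hℓ (by decide)
  · exact cellL7e105_s2 Δ (by exact_mod_cast hℓΔ) hΔ.le
  · exact absurd hℓ (by decide)
  · exact cellL7e105_s4 Δ (by exact_mod_cast hℓΔ) hΔ.le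
  · exact absurd hℓ (by decide)
  · exact cellL7e105_s6 Δ (by exact_mod_cast hℓΔ) hΔ.le
  · exact absurd hℓ (by decide)
  · exact cellL7e105_s8 Δ (by exact_mod_cast hℓΔ) hΔ.le
  · exact absurd hℓ (by decide)
  · exact cellL7e105_s10 Δ (by exact_mod_cast hℓΔ) hΔ.le
  · exact absurd hℓ (by decide)
  · exact cellL7e105_s12 Δ (by exact_mod_cast hℓΔ) hΔ.le
  · exact absurd hℓ (by decide)
  · exact cellL7e105_s14 Δ (by exact_mod_cast hℓΔ) hΔ.le
  · exact absurd hℓ (by decide)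
  · exact cellL7e105_s16 Δ (by exact_mod_cast hℓΔ) hΔ.le
  · exact absurd hℓ (by decide)
  · exact cellL7e105_s18 Δ (by exact_mod_cast hℓΔ) hΔ.le
  · exact absurd hℓ (by decide)
  · exact cellL7e105_s20 Δ (by exact_mod_cast hℓΔ) hΔ.le
  · exact absurd hℓ (by decide)
  · exact cellL7e105_s22 Δ (by exact_mod_cast hℓΔ) hΔ.le
  · exact absurd hℓ (by decide)

end Summit.CriticalPhenomena.Ising3D.Control2D
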